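import Literature.Probability.LatticeModels.CriticalScalingDimension
import HarnessLib

/-!
# The two-point power law pins the scaling dimension and the renormalisation (critical Ising, `ℤ³`)

Topic `Probability/LatticeModels`; theorem-only file (no definitions, no named facts), companion of
`CriticalScalingDimension.lean`. Write `G(x) = ⟨σ₀σ_x⟩⁺_{β_c}` (`criticalTwoPoint 3`). The
*isotropic pure power law* hypothesis is the explicit `Tendsto` statement
`G(x) ‖x‖₂^{2Δ} → c` along the cofinite filter of `ℤ³` with `0 < c` (the shape of route item
`IsingEuclidUpgradeR2RotInvPowerLaw` of `Summits/CriticalPhenomena/Ising3DConformalLimit`; it is a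
HYPOTHESIS here, never asserted). Results, all elementary consequences of the tree theorem
`criticalTwoPoint_bounds_holds` (`c‖x‖^{-2} ≤ G ≤ C‖x‖^{-1}`, Duminil-Copin 2019, Thm 4.8) and of
the dyadic-mesh machinery of `CriticalScalingDimension.lean`:

* `criticalTwoPoint_tendsto_zero_cofinite` — `G(x) → 0` as `x → ∞` in `ℤ³`;
* `twoPointLaw_exponent_mem_Icc` / `twoPointLaw_exponent_pos` — a power-law exponent satisfies
  `1/2 ≤ Δ ≤ 1`;
* `scalingDimension_eq_of_twoPointLaw` — under the power law with exponent `Δ`, EVERY pointwise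
  scaling limit `(ρ, S)` of `criticalCorr 3` which is scale covariant with dimension `Δ'` and has a
  non-degenerate two-point function has `Δ' = Δ` (whatever the renormalisation `ρ`);
* `rho_sq_asymptotics_of_twoPointLaw` — and `ρ(2^{-(k+1)})² (2^{k+1})^{-2Δ} → S₂(0,e)/c`: the
  renormalisation is forced up to the constant;
* `moebius_scalingDimension_eq_of_twoPointLaw` — packaged for Möbius-covariant limits, with
  `Δ ∈ [1/2, 1]` from `scalingDimension_mem_Icc_holds`.

Informal source of the scaling relation `ρ(δ) ≍ δ^{-Δ}`, `S₂ = c r^{-2Δ}`: Di Francesco–Mathieu–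
Sénéchal 1997, §4.3.1, eqs. (4.55)–(4.56); Duminil-Copin, ICM 2022, §8.1 (renormalised limits) and
§4.2.1 (exponent `η`, `2Δ = d - 2 + η`). Nothing here is stronger than, or restates, a tree
statement; the open items of the summit are untouched. [folklore]
-/

noncomputable section

namespace Literature.Probability.LatticeModels

open Filter _root_.Topology

/-- The critical two-point function on `ℤ³` tends to `0` at infinity (squeeze between the tree
theorems `0 < c‖x‖^{-2} ≤ ⟨σ₀σ_x⟩⁺_{β_c} ≤ C‖x‖^{-1}`, `criticalTwoPoint_bounds_holds`). [folklore] -/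
theorem criticalTwoPoint_tendsto_zero_cofinite :
    Tendsto (criticalTwoPoint 3) cofinite (𝓝 0) := by
  obtain ⟨c, C, hc, hbd⟩ := criticalTwoPoint_bounds_holds (d := 3) le_rfl
  have hnorm : Tendsto (fun x : Site 3 => ‖x‖) cofinite atTop := by
    rw [← Filter.cocompact_eq_cofinite (Site 3)]
    exact tendsto_norm_cocompact_atTop
  have hupper : Tendsto (fun x : Site 3 => C * ‖x‖ ^ (-(((3 : ℕ) : ℝ) - 2))) cofinite (𝓝 0) := by
    have h := (tendsto_rpow_neg_atTop (by norm_num : (0 : ℝ) < ((3 : ℕ) : ℝ) - 2)).comp hnorm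
    simpa using h.const_mul C
  have hne : ∀ᶠ x : Site 3 in cofinite, x ≠ 0 := eventually_cofinite_ne 0
  refine tendsto_of_tendsto_of_tendsto_of_le_of_le' tendsto_const_nhds hupper ?_ ?_
  · filter_upwards [hne] with x hx
    have h1 := (hbd x hx).1
    exact le_trans (mul_nonneg hc.le (Real.rpow_nonneg (norm_nonneg _) _)) h1
  · filter_upwards [hne] with x hx
    exact (hbd x hx).2

/-- The Euclidean length of the axis lattice point `m e₁` is `|m|`. [folklore] -/
theorem sqrt_sum_sq_single_axis (m : ℤ) :
    Real.sqrt (∑ i, (((Pi.single (0 : Fin 3) m : Site 3) i : ℝ)) ^ 2) = |(m : ℝ)| := by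
  have h : (∑ i, (((Pi.single (0 : Fin 3) m : Site 3) i : ℝ)) ^ 2) = (m : ℝ) ^ 2 := by
    simp [Pi.single_apply]
  rw [h, Real.sqrt_sq_eq_abs]

/-- The axis sequence `m ↦ m e₁` tends to the cofinite filter of `ℤ³`. [folklore] -/
theorem tendsto_natCast_single_axis_cofinite :
    Tendsto (fun m : ℕ => (Pi.single (0 : Fin 3) (m : ℤ) : Site 3)) atTop cofinite := by
  rw [← Nat.cofinite_eq_atTop]
  refine Function.Injective.tendsto_cofinite fun a b h => ?_
  have := congrFun h 0
  simpa using this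

/-- If `(Δ, c)` witnesses the two-point law `P`, then `1/2 ≤ Δ ≤ 1`: along `x = m e₁` the tree
bounds `c₁ m^{-2} ≤ ⟨σ₀σ_{me₁}⟩ ≤ C m^{-1}` squeeze `⟨σ₀σ_{me₁}⟩ m^{2Δ} → c > 0`. [folklore] -/
theorem twoPointLaw_exponent_mem_Icc {Δ c : ℝ} (hc : 0 < c)
    (h : Tendsto (fun x : Site 3 =>
      criticalTwoPoint 3 x * Real.sqrt (∑ i, ((x i : ℝ)) ^ 2) ^ (2 * Δ)) cofinite (𝓝 c)) :
    Δ ∈ Set.Icc (1 / 2 : ℝ) 1 := by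
  obtain ⟨c₁, C, hc₁, hbd⟩ := criticalTwoPoint_bounds_holds (d := 3) le_rfl
  -- restrict to the axis sequence `m e₁`, `m ≥ 1`
  set x : ℕ → Site 3 := fun m => Pi.single (0 : Fin 3) ((m + 1 : ℕ) : ℤ) with hx
  set G : ℕ → ℝ := fun m => criticalTwoPoint 3 (x m) with hG
  have hxne : ∀ m, x m ≠ 0 := by
    intro m hm
    have := congrFun hm 0
    simp [hx] at this
    omega
  have hpos : ∀ m : ℕ, (0 : ℝ) < (m + 1 : ℕ) := fun m => by positivity
  have hnorm : ∀ m, (‖x m‖ : ℝ) = ((m + 1 : ℕ) : ℝ) := by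
    intro m
    rw [hx, norm_single_axis]
    push_cast
    exact abs_of_pos (by positivity)
  have hseq : Tendsto (fun m : ℕ => G m * ((m + 1 : ℕ) : ℝ) ^ (2 * Δ)) atTop (𝓝 c) := by
    have h' := h.comp (tendsto_natCast_single_axis_cofinite.comp (tendsto_add_atTop_nat 1))
    refine h'.congr fun m => ?_
    simp only [Function.comp_apply, hG, hx]
    rw [sqrt_sum_sq_single_axis, Int.cast_natCast, abs_of_pos (hpos m)]
  have hlow : ∀ m, c₁ * ((m + 1 : ℕ) : ℝ) ^ (-(((3 : ℕ) : ℝ) - 1)) ≤ G m := by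
    intro m
    have h1 := (hbd (x m) (hxne m)).1
    rwa [hnorm m] at h1
  have hupp : ∀ m, G m ≤ C * ((m + 1 : ℕ) : ℝ) ^ (-(((3 : ℕ) : ℝ) - 2)) := by
    intro m
    have h1 := (hbd (x m) (hxne m)).2
    rwa [hnorm m] at h1
  have hGnonneg : ∀ m, 0 ≤ G m := fun m =>
    le_trans (mul_nonneg hc₁.le (Real.rpow_nonneg (hpos m).le _)) (hlow m)
  have hcast : Tendsto (fun m : ℕ => ((m + 1 : ℕ) : ℝ)) atTop atTop :=
    tendsto_natCast_atTop_atTop.comp (tendsto_add_atTop_nat 1)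
  constructor
  · -- `Δ < 1/2` would force the limit to be `≤ 0`
    by_contra hlt
    rw [not_le] at hlt
    have hexp : 0 < ((3 : ℕ) : ℝ) - 2 - 2 * Δ := by push_cast; linarith
    have hup' : ∀ m, G m * ((m + 1 : ℕ) : ℝ) ^ (2 * Δ)
        ≤ C * ((m + 1 : ℕ) : ℝ) ^ (-(((3 : ℕ) : ℝ) - 2 - 2 * Δ)) := by
      intro m
      have hm := hpos m
      calc G m * ((m + 1 : ℕ) : ℝ) ^ (2 * Δ)
          ≤ C * ((m + 1 : ℕ) : ℝ) ^ (-(((3 : ℕ) : ℝ) - 2)) * ((m + 1 : ℕ) : ℝ) ^ (2 * Δ) :=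
            mul_le_mul_of_nonneg_right (hupp m) (Real.rpow_nonneg hm.le _)
        _ = C * ((m + 1 : ℕ) : ℝ) ^ (-(((3 : ℕ) : ℝ) - 2 - 2 * Δ)) := by
            rw [mul_assoc, ← Real.rpow_add hm]; congr 2; ring
    have hzero : Tendsto (fun m : ℕ => C * ((m + 1 : ℕ) : ℝ) ^ (-(((3 : ℕ) : ℝ) - 2 - 2 * Δ)))
        atTop (𝓝 0) := by
      have h0 := (tendsto_rpow_neg_atTop hexp).comp hcast
      simpa using h0.const_mul C
    have hle : c ≤ 0 :=
      le_of_tendsto_of_tendsto' hseq hzero fun m => hup' m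
    linarith
  · -- `1 < Δ` would force the sequence to `+∞`
    by_contra hlt
    rw [not_le] at hlt
    have hexp : 0 < 2 * Δ - (((3 : ℕ) : ℝ) - 1) := by push_cast; linarith
    have hlow' : ∀ m, c₁ * ((m + 1 : ℕ) : ℝ) ^ (2 * Δ - (((3 : ℕ) : ℝ) - 1))
        ≤ G m * ((m + 1 : ℕ) : ℝ) ^ (2 * Δ) := by
      intro m
      have hm := hpos m
      calc c₁ * ((m + 1 : ℕ) : ℝ) ^ (2 * Δ - (((3 : ℕ) : ℝ) - 1))
          = c₁ * ((m + 1 : ℕ) : ℝ) ^ (-(((3 : ℕ) : ℝ) - 1)) * ((m + 1 : ℕ) : ℝ) ^ (2 * Δ) := by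
            rw [mul_assoc, ← Real.rpow_add hm]; congr 2; ring
        _ ≤ G m * ((m + 1 : ℕ) : ℝ) ^ (2 * Δ) :=
            mul_le_mul_of_nonneg_right (hlow m) (Real.rpow_nonneg hm.le _)
    have hinf : Tendsto (fun m : ℕ => c₁ * ((m + 1 : ℕ) : ℝ) ^ (2 * Δ - (((3 : ℕ) : ℝ) - 1)))
        atTop atTop :=
      Tendsto.const_mul_atTop hc₁ ((tendsto_rpow_atTop hexp).comp hcast)
    have hinf' : Tendsto (fun m : ℕ => G m * ((m + 1 : ℕ) : ℝ) ^ (2 * Δ)) atTop atTop :=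
      tendsto_atTop_mono hlow' hinf
    exact hseq.not_tendsto (disjoint_nhds_atTop c) hinf'

/-- Hence the hypothesis `P` already supplies a positive dimension: `0 < Δ`. [folklore] -/
theorem twoPointLaw_exponent_pos {Δ c : ℝ} (hc : 0 < c)
    (h : Tendsto (fun x : Site 3 =>
      criticalTwoPoint 3 x * Real.sqrt (∑ i, ((x i : ℝ)) ^ 2) ^ (2 * Δ)) cofinite (𝓝 c)) :
    0 < Δ :=
  lt_of_lt_of_le (by norm_num) (twoPointLaw_exponent_mem_Icc hc h).1


/-- The dyadic axis points `2^{k+1} e₁` tend to the cofinite filter. [folklore] -/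
theorem tendsto_dyadic_single_axis_cofinite :
    Tendsto (fun k : ℕ => (Pi.single (0 : Fin 3) ((2 : ℤ) ^ (k + 1)) : Site 3)) atTop cofinite := by
  rw [← Nat.cofinite_eq_atTop]
  refine Function.Injective.tendsto_cofinite fun a b h => ?_
  have h0 := congrFun h 0
  simp only [Pi.single_eq_same] at h0
  have h1 : (2 : ℕ) ^ (a + 1) = 2 ^ (b + 1) := by exact_mod_cast h0
  have h2 := Nat.pow_right_injective (le_refl 2) h1
  omega

/-- Along the dyadic axis points the two-point law reads
`⟨σ₀σ_{2^{k+1}e₁}⟩ (2^{k+1})^{2Δ} → c`. [folklore] -/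
theorem twoPointLaw_tendsto_dyadic {Δ c : ℝ}
    (hP : Tendsto (fun x : Site 3 =>
      criticalTwoPoint 3 x * Real.sqrt (∑ i, ((x i : ℝ)) ^ 2) ^ (2 * Δ)) cofinite (𝓝 c)) :
    Tendsto (fun k : ℕ => criticalTwoPoint 3 (Pi.single (0 : Fin 3) ((2 : ℤ) ^ (k + 1))) *
      ((2 : ℝ) ^ (k + 1)) ^ (2 * Δ)) atTop (𝓝 c) := by
  refine (hP.comp tendsto_dyadic_single_axis_cofinite).congr fun k => ?_
  simp only [Function.comp_apply]
  congr 2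
  have h : (∑ i, (((Pi.single (0 : Fin 3) ((2 : ℤ) ^ (k + 1)) : Site 3) i : ℝ)) ^ 2)
      = ((2 : ℝ) ^ (k + 1)) ^ 2 := by
    simp [Pi.single_apply]
  rw [h, Real.sqrt_sq (by positivity)]

/-- The tree's dyadic convergence, restated with `2^{k+1}` in place of `1 * 2^{k+1}`. [folklore] -/
theorem tendsto_rescaled_dyadic_pow_one {ρ : ℝ → ℝ} {S : CorrFamily 3}
    (hlim : HasPointwiseScalingLimit (criticalCorr 3) ρ S) :
    Tendsto (fun k : ℕ => ρ ((2 : ℝ)⁻¹ ^ (k + 1)) ^ 2 *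
        criticalTwoPoint 3 (Pi.single (0 : Fin 3) ((2 : ℤ) ^ (k + 1)))) atTop
      (𝓝 (S 2 ![0, EuclideanSpace.single (0 : Fin 3) ((1 : ℕ) : ℝ)])) := by
  refine (tendsto_rescaled_dyadic hlim (t := 1) one_ne_zero).congr fun k => ?_
  simp

/-- The same at `(0, 2e)`: `ρ(δ_k)² ⟨σ₀σ_{2^{k+2}e₁}⟩ → S₂(0,2e)`. [folklore] -/
theorem tendsto_rescaled_dyadic_pow_two {ρ : ℝ → ℝ} {S : CorrFamily 3}
    (hlim : HasPointwiseScalingLimit (criticalCorr 3) ρ S) :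
    Tendsto (fun k : ℕ => ρ ((2 : ℝ)⁻¹ ^ (k + 1)) ^ 2 *
        criticalTwoPoint 3 (Pi.single (0 : Fin 3) ((2 : ℤ) ^ (k + 1 + 1)))) atTop
      (𝓝 (S 2 ![0, EuclideanSpace.single (0 : Fin 3) ((2 : ℕ) : ℝ)])) := by
  refine (tendsto_rescaled_dyadic hlim (t := 2) two_ne_zero).congr fun k => ?_
  simp only [Nat.cast_ofNat]
  congr 3
  ring

/-- **Rigidity of the dimension.** If `(Δ, c)` witnesses the two-point law `P`, then every
candidate `(ρ, Δ', S)` for `Q` — indeed every scale-covariant non-degenerate pointwise scaling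
limit of `criticalCorr 3`, Möbius or not, with any renormalisation — has `Δ' = Δ`. [folklore] -/
theorem scalingDimension_eq_of_twoPointLaw {Δ c : ℝ} (hc : 0 < c)
    (hP : Tendsto (fun x : Site 3 =>
      criticalTwoPoint 3 x * Real.sqrt (∑ i, ((x i : ℝ)) ^ 2) ^ (2 * Δ)) cofinite (𝓝 c))
    {ρ : ℝ → ℝ} {Δ' : ℝ} {S : CorrFamily 3}
    (hlim : HasPointwiseScalingLimit (criticalCorr 3) ρ S) (hsc : IsScaleCovariant Δ' S)
    (hnd : IsNondegenerateTwoPoint S) : Δ' = Δ := by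
  -- notation
  set G : ℕ → ℝ := fun k => criticalTwoPoint 3 (Pi.single (0 : Fin 3) ((2 : ℤ) ^ (k + 1))) with hG
  set P2 : ℕ → ℝ := fun k => ((2 : ℝ) ^ (k + 1)) ^ (2 * Δ) with hP2
  set R : ℕ → ℝ := fun k => ρ ((2 : ℝ)⁻¹ ^ (k + 1)) ^ 2 with hR
  set s₁ := S 2 ![0, EuclideanSpace.single (0 : Fin 3) ((1 : ℕ) : ℝ)] with hs₁
  have hs₁pos : 0 < s₁ := hnd _ (zero_unitVec_mem_nonCoincident (by norm_num))
  -- the four convergent sequences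
  have ha : Tendsto (fun k => G k * P2 k) atTop (𝓝 c) := twoPointLaw_tendsto_dyadic hP
  have ha' : Tendsto (fun k => G (k + 1) * P2 (k + 1)) atTop (𝓝 c) :=
    ha.comp (tendsto_add_atTop_nat 1)
  have hr : Tendsto (fun k => R k * G k) atTop (𝓝 s₁) := tendsto_rescaled_dyadic_pow_one hlim
  have hr2 : Tendsto (fun k => R k * G (k + 1)) atTop (𝓝 ((2 : ℝ) ^ (-(2 : ℝ) * Δ') * s₁)) := by
    have h := tendsto_rescaled_dyadic_pow_two hlim
    rwa [S_two_unitVec_eq hsc] at h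
  -- the exact identity `(R G') (G P2) · 2^{2Δ} = (R G)(G' P2')`, from `P2 (k+1) = 2^{2Δ} P2 k`
  have hP2succ : ∀ k, P2 (k + 1) = (2 : ℝ) ^ (2 * Δ) * P2 k := by
    intro k
    simp only [hP2]
    rw [pow_succ, Real.mul_rpow (by positivity) (by positivity), mul_comm]
  have hid : ∀ k, (R k * G (k + 1)) * (G k * P2 k) * (2 : ℝ) ^ (2 * Δ)
      = (R k * G k) * (G (k + 1) * P2 (k + 1)) := by
    intro k; rw [hP2succ k]; ring
  have hL : Tendsto (fun k => (R k * G (k + 1)) * (G k * P2 k) * (2 : ℝ) ^ (2 * Δ)) atTop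
      (𝓝 ((2 : ℝ) ^ (-(2 : ℝ) * Δ') * s₁ * c * (2 : ℝ) ^ (2 * Δ))) :=
    (hr2.mul ha).mul_const _
  have hR' : Tendsto (fun k => (R k * G k) * (G (k + 1) * P2 (k + 1))) atTop (𝓝 (s₁ * c)) :=
    hr.mul ha'
  have heq : (2 : ℝ) ^ (-(2 : ℝ) * Δ') * s₁ * c * (2 : ℝ) ^ (2 * Δ) = s₁ * c :=
    tendsto_nhds_unique (hL.congr hid) hR'
  -- cancel `s₁ c > 0` and compare exponents
  have hsc0 : s₁ * c ≠ 0 := (mul_pos hs₁pos hc).ne'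
  have h1 : (2 : ℝ) ^ (-(2 : ℝ) * Δ') * (2 : ℝ) ^ (2 * Δ) = 1 := by
    have h' : ((2 : ℝ) ^ (-(2 : ℝ) * Δ') * (2 : ℝ) ^ (2 * Δ)) * (s₁ * c) = 1 * (s₁ * c) := by
      linear_combination heq
    exact mul_right_cancel₀ hsc0 h'
  rw [← Real.rpow_add (by norm_num : (0 : ℝ) < 2)] at h1
  have h2 : -(2 : ℝ) * Δ' + 2 * Δ = 0 := by
    have h3 := congrArg Real.log h1
    rw [Real.log_rpow (by norm_num : (0 : ℝ) < 2), Real.log_one] at h3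
    have hlog : Real.log 2 ≠ 0 := (Real.log_pos (by norm_num)).ne'
    exact (mul_eq_zero.1 h3).resolve_right hlog
  linarith

/-- **Rigidity of the renormalisation.** Under the two-point law `(Δ, c)`, every pointwise
scaling limit of `criticalCorr 3` with non-degenerate two-point function has
`ρ(δ_k)² (2^{k+1})^{-2Δ} → S₂(0,e)/c` along the dyadic meshes `δ_k = 2^{-(k+1)}`, i.e.
`ρ(δ) ≍ δ^{-Δ}`: the renormalisation is forced up to the constant `S₂(0,e)/c`. [folklore] -/
theorem rho_sq_asymptotics_of_twoPointLaw {Δ c : ℝ} (hc : 0 < c)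
    (hP : Tendsto (fun x : Site 3 =>
      criticalTwoPoint 3 x * Real.sqrt (∑ i, ((x i : ℝ)) ^ 2) ^ (2 * Δ)) cofinite (𝓝 c))
    {ρ : ℝ → ℝ} {S : CorrFamily 3}
    (hlim : HasPointwiseScalingLimit (criticalCorr 3) ρ S) :
    Tendsto (fun k : ℕ => ρ ((2 : ℝ)⁻¹ ^ (k + 1)) ^ 2 * (((2 : ℝ) ^ (k + 1)) ^ (2 * Δ))⁻¹) atTop
      (𝓝 (S 2 ![0, EuclideanSpace.single (0 : Fin 3) ((1 : ℕ) : ℝ)] / c)) := by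
  set G : ℕ → ℝ := fun k => criticalTwoPoint 3 (Pi.single (0 : Fin 3) ((2 : ℤ) ^ (k + 1))) with hG
  set P2 : ℕ → ℝ := fun k => ((2 : ℝ) ^ (k + 1)) ^ (2 * Δ) with hP2
  set R : ℕ → ℝ := fun k => ρ ((2 : ℝ)⁻¹ ^ (k + 1)) ^ 2 with hR
  have ha : Tendsto (fun k => G k * P2 k) atTop (𝓝 c) := twoPointLaw_tendsto_dyadic hP
  have hr : Tendsto (fun k => R k * G k) atTop (𝓝 (S 2 ![0, EuclideanSpace.single (0 : Fin 3)
      ((1 : ℕ) : ℝ)])) := tendsto_rescaled_dyadic_pow_one hlim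
  have hev : ∀ᶠ k in atTop, G k * P2 k ≠ 0 := ha.eventually_ne hc.ne'
  refine (hr.div ha hc.ne').congr' ?_
  filter_upwards [hev] with k hk
  have hGk : G k ≠ 0 := fun h => hk (by rw [h, zero_mul])
  show R k * G k / (G k * P2 k) = R k * (P2 k)⁻¹
  rw [← div_div, mul_div_cancel_right₀ _ hGk, div_eq_mul_inv]

/-- Consequence for the crux: given `P` with exponent `Δ`, any witness `(ρ, Δ', S)` of `Q` has
`Δ' = Δ ∈ [1/2, 1]` — consistent with, and sharper than, the tree theorem
`scalingDimension_mem_Icc_holds` (`1/2 ≤ Δ' ≤ 1` for every such witness). [folklore] -/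
theorem moebius_scalingDimension_eq_of_twoPointLaw {Δ c : ℝ} (hc : 0 < c)
    (hP : Tendsto (fun x : Site 3 =>
      criticalTwoPoint 3 x * Real.sqrt (∑ i, ((x i : ℝ)) ^ 2) ^ (2 * Δ)) cofinite (𝓝 c))
    {ρ : ℝ → ℝ} {Δ' : ℝ} {S : CorrFamily 3} (hρ : ∀ δ ∈ Set.Ioc (0 : ℝ) 1, 0 < ρ δ)
    (hlim : HasPointwiseScalingLimit (criticalCorr 3) ρ S) (hnd : IsNondegenerateTwoPoint S)
    (hM : IsMoebiusCovariant Δ' S) : Δ' = Δ ∧ Δ ∈ Set.Icc (1 / 2 : ℝ) 1 := by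
  have h1 := scalingDimension_eq_of_twoPointLaw hc hP hlim hM.isScaleCovariant hnd
  refine ⟨h1, ?_⟩
  rw [← h1]
  exact scalingDimension_mem_Icc_holds ρ Δ' S hlim hM.isScaleCovariant hnd hρ


end Literature.Probability.LatticeModels
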